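import Literature.NumberTheory.Automorphic.UnitaryGroupIwasawaWeightExchange
import Literature.NumberTheory.Automorphic.UnitaryGroupBorelProductWeightIntegral
import Literature.NumberTheory.Automorphic.UnitaryGroupRationalBorelCoveringWeights
import Literature.NumberTheory.Automorphic.UnitaryGroupTorusWindowIntegral
import Literature.NumberTheory.Automorphic.UnitaryGroupTorusThreeRay
import Literature.NumberTheory.Automorphic.UnitaryGroupCuspIntegralSiegelMajorant
import HarnessLib

/-!
# The window parts of Arthur's `J^{T'}(f) − J^{T}(f)` on `U(3)` integrate to `K_θ · (log T' − log T)`: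
# Iwasawa coordinates, weight exchange, the thin-set equality and the ray invariance, composed
(Arthur, *The trace formula in invariant form*, Ann. of Math. 114 (1981), §2: `J^T(f)` is a polynomial in `T`;
Rogawski, *Automorphic Representations of Unitary Groups in Three Variables* (1990), §2.1 p. 12)

Topic `NumberTheory/Automorphic`; namespace `Literature.NumberTheory.Automorphic.UnitaryGroup`. THEOREMS ONLY
over accepted tree modules: no definition, no named fact, no instance, no notation, no `sorry`. Piece (L2-e1) of
the road to the T1-qs law ★ `UnitaryGroup.TruncatedTracePolynomial`: after ★ L2-a
(`truncatedKernel_sub_truncatedKernel`) and the exact unfolding ★ L2-u ∕ (L2-uℂ), `J^{T'}(f) − J^{T}(f)` is a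
combination of four integrals `∫⁻_{G(𝔸)} β(y) · 1_{T < H(y) ≤ T'} θ(y) dν_G` with `β` a covering weight of `B(F)`
and `θ` one of the four nonnegative parts `ofReal (±re ∕ ±im K_B(y, y))` of the diagonal Borel kernel — each
`δ_B`-HOMOGENEOUS: `θ(b k) = δ_B(b) θ(k)` (`b ∈ B(𝔸)`, `k ∈ K_U`; ★ `kernelBorel_borel_mul_mul`). THIS FILE: for
every such homogeneous measurable `θ`,
  `∫⁻ β · 1_{T<H≤T'} θ dν_G = D · (∫⁻_{K_U} θ dμ_K) · (log T' − log T)`   (`0 < T ≤ T'`),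
with ONE constant `D` (independent of `θ, T, T'`), by composing
★ L2-i `lintegral_weight_iwasawa_eq_three` (Iwasawa `G = B K_U` + exchange of `β(· k)` for the product weight
`1_Ω(b t_b⁻¹) w_T(t_b)` of ★ L2-w `exists_isCoveringWeight_borel_indicator_mul`), ★ L2-i′
`exists_lintegral_productWeight_mul_torusRootModulus_mul_eq` (order `b = n t`: `δ_B d_ℓb = dn dt`), and ★ L2-dT
`exists_lintegral_weight_mul_indicator_window_eq` (ray invariance on the torus ⇒ `C_T (log T' − log T)`), the torus
Siegel set being read in the coordinates of ★ `UnitaryGroupTorusThreeRay` (`d₀(t) ∈ C₀ · z_E(ℝ_{>0})`, `d₁(t) ∈ C₁`,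
exactly the EXPORT clause of row H9a).

* §1 `exists_subset_range_torusRay_mul` — the coordinate Siegel set lies in `ρ(ℝ) · 𝔎` for the diagonal ray (as in ★
  `setLIntegral_rpow_neg_borelHeight_lt_top_of_diagUnit`); `exists_lintegral_weight_mul_indicator_window_eq_of_diagUnit`
  — ★ L2-dT in coordinates.
* §2 **`exists_lintegral_weight_windowPart_eq`** — THE WINDOW PARTS.

## References

* J. Arthur, *The trace formula in invariant form*, Ann. of Math. 114 (1981), §2 [Arthur1981TraceFormulaInvariantForm].
* J. D. Rogawski, *Automorphic Representations of Unitary Groups in Three Variables*, Annals of Mathematics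
  Studies 123 (1990), §2.1 (p. 12), §2.2 (p. 13) [Rogawski1990].
-/

set_option autoImplicit false

noncomputable section

open MeasureTheory Measure NumberField IsDedekindDomain Set Literature.MeasureTheory.Group
open scoped NNReal ENNReal Pointwise

namespace Literature.NumberTheory.Automorphic

namespace UnitaryGroup

variable {F E : Type} [Field F] [NumberField F] [Field E] [NumberField E] [Algebra F E]
  {c : E ≃ₐ[F] E}

variable [MeasurableSpace (quasiSplit F E c 3).Adelic] [BorelSpace (quasiSplit F E c 3).Adelic]

/-! ## §1 The torus window integral in the coordinates of the diagonal ray -/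

omit [MeasurableSpace (quasiSplit F E c 3).Adelic] [BorelSpace (quasiSplit F E c 3).Adelic] in
/-- **A coordinate torus Siegel set lies in `ρ(ℝ) · 𝔎`**: if every `t ∈ S` has `d₀(t) = w · z_E(e^s)` with `w ∈ C₀`
and `d₁(t) ∈ C₁` (`C₀, C₁ ⊆ 𝕀_E` compact), then `S ⊆ ρ(ℝ) · {d₀ ∈ C₀, d₁ ∈ C₁}` for the diagonal ray `ρ` of ★
`exists_torusRay` (`t = ρ(s) · (ρ(−s) t)`). [cite: Rogawski1990, §2.2 (p. 13)] -/
theorem exists_subset_range_torusRay_mul (hc : c * c = 1) {C₀ C₁ : Set (AdeleRing (𝓞 E) E)ˣ}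
    {S : Set (torusInBorel F E c 3)}
    (hS : ∀ t ∈ S, (∃ w ∈ C₀, ∃ s : ℝ, diagUnit (t : borelAdelic F E c 3).2 0 = w * posRealIdele E (expUnitNNReal s)) ∧
      diagUnit (t : borelAdelic F E c 3).2 1 ∈ C₁) :
    ∃ ρ : ℝ → torusInBorel F E c 3, Continuous ρ ∧
      (∀ (s : ℝ) (t : torusInBorel F E c 3),
        (borelHeight (((ρ s * t : torusInBorel F E c 3) : borelAdelic F E c 3) : (quasiSplit F E c 3).Adelic) : ℝ) =
          Real.exp (Module.finrank ℚ E * s) *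
            borelHeight (((t : torusInBorel F E c 3) : borelAdelic F E c 3) : (quasiSplit F E c 3).Adelic)) ∧
      S ⊆ Set.range ρ * {t : torusInBorel F E c 3 |
        diagUnit (t : borelAdelic F E c 3).2 0 ∈ C₀ ∧ diagUnit (t : borelAdelic F E c 3).2 1 ∈ C₁} := by
  obtain ⟨ρ, hρc, hρadd, hρd, hH⟩ := exists_torusRay (F := F) (E := E) (c := c) hc
  have hρ0 : ρ 0 = 1 := by
    have h := hρadd 0 0
    rw [add_zero] at h
    exact mul_eq_left.1 h.symm
  have hadd : ∀ a b : ℝ, expUnitNNReal (a + b) = expUnitNNReal a * expUnitNNReal b := fun a b => by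
    ext
    change Real.exp (a + b) = Real.exp a * Real.exp b
    exact Real.exp_add a b
  have hz : ∀ s : ℝ, posRealIdele E (expUnitNNReal (-s)) * posRealIdele E (expUnitNNReal s) = 1 := fun s => by
    rw [← map_mul, ← hadd, neg_add_cancel]
    have h0 : expUnitNNReal 0 = 1 := by
      ext
      change Real.exp 0 = 1
      exact Real.exp_zero
    rw [h0, map_one]
  refine ⟨ρ, hρc, hH, fun t ht => ?_⟩
  obtain ⟨⟨w, hw, s, hs⟩, h1⟩ := hS t ht
  refine Set.mem_mul.2 ⟨ρ s, ⟨s, rfl⟩, ρ (-s) * t, ⟨?_, ?_⟩, ?_⟩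
  · show diagUnit ((ρ (-s) * t : torusInBorel F E c 3) : borelAdelic F E c 3).2 0 ∈ C₀
    rw [diagUnit_torus_mul, (hρd (-s)).1, hs, mul_left_comm, hz, mul_one]
    exact hw
  · show diagUnit ((ρ (-s) * t : torusInBorel F E c 3) : borelAdelic F E c 3).2 1 ∈ C₁
    rw [diagUnit_torus_mul, (hρd (-s)).2, one_mul]
    exact h1
  · rw [← mul_assoc, ← hρadd, add_neg_cancel, hρ0, one_mul]

/-- **THE TORUS WINDOW INTEGRAL IN COORDINATES** (★ `exists_lintegral_weight_mul_indicator_window_eq` fed by §1 and ★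
`isCompact_setOf_diagUnit_mem`): for a left-invariant measure `μ_T` finite on compacts on `T(𝔸_F) ≤ U(J₃)(𝔸_F)`, a
covering weight `w_T` of the rational torus, and a measurable torus Siegel set `S` meeting every `T(F)`-orbit whose
elements have `d₀ ∈ C₀ · z_E(ℝ_{>0})`, `d₁ ∈ C₁` (`C₀, C₁` compact): `∫⁻ w_T · 1_{T<H≤T'} dμ_T = C · (log T' − log T)`
for all `0 < T ≤ T'`, some `C < ∞`. [cite: Arthur1981TraceFormulaInvariantForm, §2] [cite: Rogawski1990, §2.1 (p. 12)] -/
theorem exists_lintegral_weight_mul_indicator_window_eq_of_diagUnit (hc : c * c = 1)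
    (μT : Measure (torusInBorel F E c 3)) [μT.IsMulLeftInvariant] [IsFiniteMeasureOnCompacts μT]
    {wT : torusInBorel F E c 3 → ℝ≥0∞}
    (hwT : IsCoveringWeight ((rationalBorel F E c 3).subgroupOf (torusInBorel F E c 3)) wT)
    {C₀ C₁ : Set (AdeleRing (𝓞 E) E)ˣ} (hC₀ : IsCompact C₀) (hC₁ : IsCompact C₁)
    {S : Set (torusInBorel F E c 3)} (hSm : MeasurableSet S)
    (hS : ∀ t ∈ S, (∃ w ∈ C₀, ∃ s : ℝ, diagUnit (t : borelAdelic F E c 3).2 0 = w * posRealIdele E (expUnitNNReal s)) ∧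
      diagUnit (t : borelAdelic F E c 3).2 1 ∈ C₁)
    (hcov : ∀ t : torusInBorel F E c 3,
      ∃ τ : (rationalBorel F E c 3).subgroupOf (torusInBorel F E c 3), τ • t ∈ S) :
    ∃ C : ℝ≥0∞, C ≠ ⊤ ∧ ∀ T T' : ℝ≥0, 0 < T → T ≤ T' →
      ∫⁻ t, wT t * {t : torusInBorel F E c 3 |
          T < borelHeight (((t : torusInBorel F E c 3) : borelAdelic F E c 3) : (quasiSplit F E c 3).Adelic) ∧
          borelHeight (((t : torusInBorel F E c 3) : borelAdelic F E c 3) : (quasiSplit F E c 3).Adelic) ≤ T'}.indicator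
          1 t ∂μT =
        C * ENNReal.ofReal (Real.log (T' : ℝ) - Real.log (T : ℝ)) := by
  obtain ⟨ρ, hρc, hH, hsub⟩ := exists_subset_range_torusRay_mul (F := F) (E := E) (c := c) hc hS
  have h𝔎 := isCompact_setOf_diagUnit_mem (F := F) hc hC₀ hC₁
  have hκ : 0 < (Module.finrank ℚ E : ℝ) := Nat.cast_pos.2 Module.finrank_pos
  exact exists_lintegral_weight_mul_indicator_window_eq μT hwT h𝔎 hρc hκ hH hSm hsub hcov

/-! ## §2 The window parts -/

/-- **THE WINDOW PARTS OF `J^{T'} − J^{T}`.**  Let `ν_G, μ_B, μ_K, μ_T, μ_N` be Haar measures of `U(J₃)(𝔸_F)`,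
`B(𝔸_F)`, `K_U`, `T(𝔸_F)`, `N(𝔸_F)`, assume the Iwasawa decomposition `G(𝔸) = B(𝔸) K_U` (`hBK`, ★ for CM pairs), let
`S ⊆ T(𝔸_F)` be a measurable coordinate torus Siegel set meeting every `T(F)`-orbit (row H9a: EXPORT + COVER), and
`β` a covering weight of `B(F)♯` on `G(𝔸_F)`. There is ONE constant `D ∈ [0, ∞]` such that for every measurable
`θ ≥ 0` on `G(𝔸_F)` which is `δ_B`-homogeneous (`θ(b k) = δ_B(b) θ(k)`, `b ∈ B(𝔸)`, `k ∈ K_U` — the four parts of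
`K_B(y,y)`, ★ `kernelBorel_borel_mul_mul`) and all `0 < T ≤ T'`:
`∫⁻ β(y) · 1_{T < H(y) ≤ T'} θ(y) dν_G = D · (∫⁻_{K_U} θ dμ_K) · (log T' − log T)`.
[cite: Arthur1981TraceFormulaInvariantForm, §2] [cite: Rogawski1990, §2.1 (p. 12)] -/
theorem exists_lintegral_weight_windowPart_eq (hc : c * c = 1) (hc1 : c ≠ 1)
    (νG : Measure (quasiSplit F E c 3).Adelic) [νG.IsHaarMeasure]
    (μB : Measure (borelAdelic F E c 3)) [μB.IsHaarMeasure]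
    (μK : Measure ((standardMaximalCompactGL 3 E).comap
      (adelicVal F E c 3 ((StdForm.antidiagonal 3).over E)) : Subgroup (quasiSplit F E c 3).Adelic))
    [μK.IsHaarMeasure]
    (μT : Measure (torusInBorel F E c 3)) [μT.IsHaarMeasure]
    (μN : Measure (unipotentInBorel F E c 3)) [μN.IsHaarMeasure]
    (hBK : ∀ g : (quasiSplit F E c 3).Adelic, ∃ b ∈ borelAdelic F E c 3, ∃ k : (quasiSplit F E c 3).Adelic,
      adelicVal F E c 3 ((StdForm.antidiagonal 3).over E) k ∈ standardMaximalCompactGL 3 E ∧ g = b * k)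
    {C₀ C₁ : Set (AdeleRing (𝓞 E) E)ˣ} (hC₀ : IsCompact C₀) (hC₁ : IsCompact C₁)
    {S : Set (torusInBorel F E c 3)} (hSm : MeasurableSet S)
    (hS : ∀ t ∈ S, (∃ w ∈ C₀, ∃ s : ℝ, diagUnit (t : borelAdelic F E c 3).2 0 = w * posRealIdele E (expUnitNNReal s)) ∧
      diagUnit (t : borelAdelic F E c 3).2 1 ∈ C₁)
    (hcov : ∀ t : torusInBorel F E c 3,
      ∃ τ : (rationalBorel F E c 3).subgroupOf (torusInBorel F E c 3), τ • t ∈ S)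
    {β : (quasiSplit F E c 3).Adelic → ℝ≥0∞}
    (hβ : IsCoveringWeight ((arithmeticBorel F E c 3).map (quasiSplit F E c 3).arithmeticSubgroup.subtype) β) :
    ∃ D : ℝ≥0∞, ∀ θ : (quasiSplit F E c 3).Adelic → ℝ≥0∞, Measurable θ →
      (∀ (b : borelAdelic F E c 3) (k : (quasiSplit F E c 3).Adelic),
        adelicVal F E c 3 ((StdForm.antidiagonal 3).over E) k ∈ standardMaximalCompactGL 3 E →
        θ ((b : (quasiSplit F E c 3).Adelic) * k) = ((torusRootModulus E 3 (diagUnit b.2) : ℝ≥0) : ℝ≥0∞) * θ k) →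
      ∀ T T' : ℝ≥0, 0 < T → T ≤ T' →
        ∫⁻ y, β y * {y : (quasiSplit F E c 3).Adelic | T < borelHeight y ∧ borelHeight y ≤ T'}.indicator θ y ∂νG =
          D * (∫⁻ k, θ (k : (quasiSplit F E c 3).Adelic) ∂μK) *
            ENNReal.ofReal (Real.log (T' : ℝ) - Real.log (T : ℝ)) := by
  -- the product weight `w = 1_Ω(b t_b⁻¹) · w_T(t_b)` of `B(F)` on `B(𝔸)`
  obtain ⟨Ω, wT, hΩm, hΩu, hwT, hw⟩ :=
    exists_isCoveringWeight_borel_indicator_mul (F := F) (E := E) (c := c) (N := 3)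
  -- the three constants: Iwasawa + exchange, `δ_B d_ℓb = dn dt`, ray invariance
  obtain ⟨Ci, -, -, hLi⟩ := lintegral_weight_iwasawa_eq_three (F := F) (E := E) (c := c) νG μB μK hBK
  obtain ⟨Cp, -, -, -, hLp⟩ := exists_lintegral_productWeight_mul_torusRootModulus_mul_eq (F := F) (E := E)
    hc hc1 μB μT μN
  obtain ⟨CT, -, hLT⟩ := exists_lintegral_weight_mul_indicator_window_eq_of_diagUnit (F := F) (E := E) hc μT
    hwT hC₀ hC₁ hSm hS hcov
  refine ⟨Ci * (Cp * μN Ω * CT), fun θ hθ hθhom T T' hT hTT' => ?_⟩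
  -- the Borel factor `Φ(b) = 1_{T < H(b) ≤ T'} δ_B(b)` and the torus window `φ`
  set Φ : borelAdelic F E c 3 → ℝ≥0∞ := fun b =>
    {b : borelAdelic F E c 3 | T < borelHeight (b : (quasiSplit F E c 3).Adelic) ∧
      borelHeight (b : (quasiSplit F E c 3).Adelic) ≤ T'}.indicator
      (fun b => ((torusRootModulus E 3 (diagUnit b.2) : ℝ≥0) : ℝ≥0∞)) b with hΦdef
  set φ : torusInBorel F E c 3 → ℝ≥0∞ := {t : torusInBorel F E c 3 |
    T < borelHeight (((t : torusInBorel F E c 3) : borelAdelic F E c 3) : (quasiSplit F E c 3).Adelic) ∧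
    borelHeight (((t : torusInBorel F E c 3) : borelAdelic F E c 3) : (quasiSplit F E c 3).Adelic) ≤ T'}.indicator 1
    with hφdef
  have hHB : Measurable fun b : borelAdelic F E c 3 => borelHeight (b : (quasiSplit F E c 3).Adelic) :=
    measurable_borelHeight.comp measurable_subtype_coe
  have hWB : MeasurableSet {b : borelAdelic F E c 3 | T < borelHeight (b : (quasiSplit F E c 3).Adelic) ∧
      borelHeight (b : (quasiSplit F E c 3).Adelic) ≤ T'} :=
    hHB (measurableSet_Ioc (a := T) (b := T'))
  have hΦm : Measurable Φ := (measurable_coe_torusRootModulus_diagUnit (F := F) (E := E) (c := c) (N := 3)).indicator hWB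
  have hHT : Measurable fun t : torusInBorel F E c 3 =>
      borelHeight (((t : torusInBorel F E c 3) : borelAdelic F E c 3) : (quasiSplit F E c 3).Adelic) :=
    measurable_borelHeight.comp (measurable_subtype_coe.comp measurable_subtype_coe)
  have hWT : MeasurableSet {t : torusInBorel F E c 3 |
      T < borelHeight (((t : torusInBorel F E c 3) : borelAdelic F E c 3) : (quasiSplit F E c 3).Adelic) ∧
      borelHeight (((t : torusInBorel F E c 3) : borelAdelic F E c 3) : (quasiSplit F E c 3).Adelic) ≤ T'} :=
    hHT (measurableSet_Ioc (a := T) (b := T'))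
  have hφm : Measurable φ := measurable_one.indicator hWT
  -- `Φ` is left `B(F)`-invariant (product formula: `H(γ b) = H(b)`, `δ_B(γ b) = δ_B(b)`)
  have hΦB : ∀ b₀ : borelAdelic F E c 3,
      (b₀ : (quasiSplit F E c 3).Adelic) ∈ (quasiSplit F E c 3).arithmeticSubgroup →
      ∀ b : borelAdelic F E c 3, Φ (b₀ * b) = Φ b := by
    intro b₀ hb₀ b
    obtain ⟨γ, hγ⟩ := hb₀
    have hγB : (quasiSplit F E c 3).toAdelic γ ∈ borelAdelic F E c 3 := by rw [hγ]; exact b₀.2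
    have hH : borelHeight (((b₀ * b : borelAdelic F E c 3)) : (quasiSplit F E c 3).Adelic) =
        borelHeight (b : (quasiSplit F E c 3).Adelic) := by
      rw [Subgroup.coe_mul, ← hγ, borelHeight_rational_borel_mul γ hγB]
    have hδ := torusRootModulus_diagUnit_rational_mul (⟨b₀, ⟨γ, hγ⟩⟩ : rationalBorel F E c 3) b
    by_cases hb : b ∈ {b : borelAdelic F E c 3 | T < borelHeight (b : (quasiSplit F E c 3).Adelic) ∧
        borelHeight (b : (quasiSplit F E c 3).Adelic) ≤ T'}
    · have hb' : b₀ * b ∈ {b : borelAdelic F E c 3 | T < borelHeight (b : (quasiSplit F E c 3).Adelic) ∧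
          borelHeight (b : (quasiSplit F E c 3).Adelic) ≤ T'} := by
        rw [Set.mem_setOf_eq, hH]; exact hb
      rw [hΦdef]
      simp only []
      rw [Set.indicator_of_mem hb', Set.indicator_of_mem hb]
      exact congrArg (fun r : ℝ≥0 => (r : ℝ≥0∞)) hδ
    · have hb' : b₀ * b ∉ {b : borelAdelic F E c 3 | T < borelHeight (b : (quasiSplit F E c 3).Adelic) ∧
          borelHeight (b : (quasiSplit F E c 3).Adelic) ≤ T'} := by
        rw [Set.mem_setOf_eq, hH]; exact hb
      rw [hΦdef]
      simp only []
      rw [Set.indicator_of_notMem hb', Set.indicator_of_notMem hb]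
  -- the Iwasawa factorisation `Ψ(b k) = Φ(b) θ(k)` of the window part
  have hΨm : Measurable fun y : (quasiSplit F E c 3).Adelic =>
      {y : (quasiSplit F E c 3).Adelic | T < borelHeight y ∧ borelHeight y ≤ T'}.indicator θ y :=
    hθ.indicator (measurable_borelHeight (measurableSet_Ioc (a := T) (b := T')))
  have hΨ : ∀ (b : borelAdelic F E c 3) (k : (quasiSplit F E c 3).Adelic),
      adelicVal F E c 3 ((StdForm.antidiagonal 3).over E) k ∈ standardMaximalCompactGL 3 E →
      {y : (quasiSplit F E c 3).Adelic | T < borelHeight y ∧ borelHeight y ≤ T'}.indicator θ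
          ((b : (quasiSplit F E c 3).Adelic) * k) = Φ b * θ k := by
    intro b k hk
    have hHk : borelHeight ((b : (quasiSplit F E c 3).Adelic) * k) = borelHeight (b : (quasiSplit F E c 3).Adelic) :=
      borelHeight_mul_of_mem_comap_standardMaximalCompactGL (Subgroup.mem_comap.2 hk) _
    by_cases hb : b ∈ {b : borelAdelic F E c 3 | T < borelHeight (b : (quasiSplit F E c 3).Adelic) ∧
        borelHeight (b : (quasiSplit F E c 3).Adelic) ≤ T'}
    · have hy : (b : (quasiSplit F E c 3).Adelic) * k ∈
          {y : (quasiSplit F E c 3).Adelic | T < borelHeight y ∧ borelHeight y ≤ T'} := by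
        rw [Set.mem_setOf_eq, hHk]; exact hb
      rw [Set.indicator_of_mem hy, hΦdef]
      simp only []
      rw [Set.indicator_of_mem hb, hθhom b k hk]
    · have hy : (b : (quasiSplit F E c 3).Adelic) * k ∉
          {y : (quasiSplit F E c 3).Adelic | T < borelHeight y ∧ borelHeight y ≤ T'} := by
        rw [Set.mem_setOf_eq, hHk]; exact hb
      rw [Set.indicator_of_notMem hy, hΦdef]
      simp only []
      rw [Set.indicator_of_notMem hb, zero_mul]
  -- Step 1: Iwasawa + weight exchange
  have h1 := hLi β hβ _ hw Φ hΦm hΦB θ _ hθ hΨm hΨ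
  rw [h1]
  -- Step 2: `Φ(b) = δ_B(b) · φ(torusPart b)` and the thin-set equality
  have hΦφ : ∀ b : borelAdelic F E c 3, Φ b =
      ((torusRootModulus E 3 (diagUnit b.2) : ℝ≥0) : ℝ≥0∞) * φ ⟨torusPart b, torusPart_mem_torusAdelic b⟩ := by
    intro b
    have hHt : borelHeight ((((⟨torusPart b, torusPart_mem_torusAdelic b⟩ : torusInBorel F E c 3) :
        borelAdelic F E c 3)) : (quasiSplit F E c 3).Adelic) = borelHeight (b : (quasiSplit F E c 3).Adelic) :=
      borelHeight_torusPart b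
    by_cases hb : b ∈ {b : borelAdelic F E c 3 | T < borelHeight (b : (quasiSplit F E c 3).Adelic) ∧
        borelHeight (b : (quasiSplit F E c 3).Adelic) ≤ T'}
    · have ht : (⟨torusPart b, torusPart_mem_torusAdelic b⟩ : torusInBorel F E c 3) ∈ {t : torusInBorel F E c 3 |
          T < borelHeight (((t : torusInBorel F E c 3) : borelAdelic F E c 3) : (quasiSplit F E c 3).Adelic) ∧
          borelHeight (((t : torusInBorel F E c 3) : borelAdelic F E c 3) : (quasiSplit F E c 3).Adelic) ≤ T'} := by
        rw [Set.mem_setOf_eq, hHt]; exact hb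
      rw [hΦdef, hφdef]
      simp only []
      rw [Set.indicator_of_mem hb, Set.indicator_of_mem ht, Pi.one_apply, mul_one]
    · have ht : (⟨torusPart b, torusPart_mem_torusAdelic b⟩ : torusInBorel F E c 3) ∉ {t : torusInBorel F E c 3 |
          T < borelHeight (((t : torusInBorel F E c 3) : borelAdelic F E c 3) : (quasiSplit F E c 3).Adelic) ∧
          borelHeight (((t : torusInBorel F E c 3) : borelAdelic F E c 3) : (quasiSplit F E c 3).Adelic) ≤ T'} := by
        rw [Set.mem_setOf_eq, hHt]; exact hb
      rw [hΦdef, hφdef]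
      simp only []
      rw [Set.indicator_of_notMem hb, Set.indicator_of_notMem ht, mul_zero]
  have h2 : ∫⁻ b, (Ω.indicator (1 : unipotentInBorel F E c 3 → ℝ≥0∞)
        ⟨b * (torusPart b)⁻¹, mul_torusPart_inv_mem_unipotentInBorel b⟩ *
        wT ⟨torusPart b, torusPart_mem_torusAdelic b⟩) * Φ b ∂μB =
      Cp * μN Ω * ∫⁻ t, wT t * φ t ∂μT := by
    simp_rw [hΦφ]
    exact hLp Ω hΩm wT hwT.measurable φ hφm
  rw [h2]
  -- Step 3: the torus window `= C_T (log T' − log T)`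
  have h3 : ∫⁻ t, wT t * φ t ∂μT = CT * ENNReal.ofReal (Real.log (T' : ℝ) - Real.log (T : ℝ)) := hLT T T' hT hTT'
  rw [h3]
  ring

end UnitaryGroup

end Literature.NumberTheory.Automorphic
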